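import Summits.ValiantsHypothesis.ValiantsHypothesis.Theorems.ToricFixedPoints.Negative.FormDeborderingPaddedEndIffDc

/-!
# `ToricFixedPoints` / line `form_then_lift`, stub F1 at `(3,m)`, `a = m - 2`: the quadratic content classes

By `FormDeborderingTestSpace` a test form of `stub_formDebordering` at `(3,m)` with `ℓ`-exponent
`a = m - 2` is `ℓ^{m-2}·G(Y)` with `G` a content-homogeneous QUADRATIC in the block variables; up to the
`S₃ × S₃ ⋊ ℤ/2` relabelling the content classes are `y₀₀²`, `y₀₀y₀₁` and `⟨y₀₀y₁₁, y₀₁y₁₀⟩`.  Each has an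
affine determinantal representation of size `2` (`hasDetRepr_quadClass₁/₂/₃`), hence `dc ≤ 2 ≤ m`, so by
`paddedBlock3_formDebordering_of_dc_le` the padded form has F1's toric shape outright for every `m ≥ 4`
(`formDebordering_padded_quadClass₃`, the two-parameter class; the monomial classes likewise).
Refuter/theory seat `val-width-5779-d1` (stmt-ValiantsHypothesis-5779).  VP ≠ VNP is not touched.
-/

open MvPolynomial Finset
open Literature.Computability.AlgebraicComplexity

namespace Summit.ValiantsHypothesis.Cruxes.ToricFixedPoints.Negative

/-- `α y₀₀² = det diag(α y₀₀, y₀₀)`. [folklore] -/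
theorem hasDetRepr_quadClass₁ (α : ℂ) :
    HasDetRepr (α • (X (0, 0) * X (0, 0)) : MvPolynomial (Fin 3 × Fin 3) ℂ) 2 := by
  refine ⟨!![α • X (0, 0), 0; 0, X (0, 0)], ?_, ?_⟩
  · intro i j
    fin_cases i <;> fin_cases j <;>
      simp only [Matrix.of_apply, Matrix.cons_val', Matrix.cons_val_zero, Matrix.cons_val_one,
        Matrix.cons_val_fin_one, Fin.zero_eta, Fin.mk_one, Fin.isValue, totalDegree_zero, zero_le,
        totalDegree_X] <;>
      first
        | exact le_rfl
        | exact (totalDegree_smul_le (_ : ℂ) (_ : MvPolynomial (Fin 3 × Fin 3) ℂ)).trans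
            (totalDegree_X (R := ℂ) _).le
  · rw [Matrix.det_fin_two_of]
    simp only [smul_mul_assoc, mul_zero, sub_zero]

/-- `α y₀₀y₀₁ = det diag(α y₀₀, y₀₁)`. [folklore] -/
theorem hasDetRepr_quadClass₂ (α : ℂ) :
    HasDetRepr (α • (X (0, 0) * X (0, 1)) : MvPolynomial (Fin 3 × Fin 3) ℂ) 2 := by
  refine ⟨!![α • X (0, 0), 0; 0, X (0, 1)], ?_, ?_⟩
  · intro i j
    fin_cases i <;> fin_cases j <;>
      simp only [Matrix.of_apply, Matrix.cons_val', Matrix.cons_val_zero, Matrix.cons_val_one,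
        Matrix.cons_val_fin_one, Fin.zero_eta, Fin.mk_one, Fin.isValue, totalDegree_zero, zero_le,
        totalDegree_X] <;>
      first
        | exact le_rfl
        | exact (totalDegree_smul_le (_ : ℂ) (_ : MvPolynomial (Fin 3 × Fin 3) ℂ)).trans
            (totalDegree_X (R := ℂ) _).le
  · rw [Matrix.det_fin_two_of]
    simp only [smul_mul_assoc, mul_zero, sub_zero]

/-- `α y₀₀y₁₁ + β y₀₁y₁₀ = det [[α y₀₀, -β y₀₁], [y₁₀, y₁₁]]`. [folklore] -/
theorem hasDetRepr_quadClass₃ (α β : ℂ) :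
    HasDetRepr (α • (X (0, 0) * X (1, 1)) + β • (X (0, 1) * X (1, 0)) :
      MvPolynomial (Fin 3 × Fin 3) ℂ) 2 := by
  refine ⟨!![α • X (0, 0), (-β) • X (0, 1); X (1, 0), X (1, 1)], ?_, ?_⟩
  · intro i j
    fin_cases i <;> fin_cases j <;>
      simp only [Matrix.of_apply, Matrix.cons_val', Matrix.cons_val_zero, Matrix.cons_val_one,
        Matrix.cons_val_fin_one, Fin.zero_eta, Fin.mk_one, Fin.isValue, totalDegree_X] <;>
      first
        | exact le_rfl
        | exact (totalDegree_smul_le (_ : ℂ) (_ : MvPolynomial (Fin 3 × Fin 3) ℂ)).trans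
            (totalDegree_X (R := ℂ) _).le
  · rw [Matrix.det_fin_two_of]
    rw [smul_mul_assoc, smul_mul_assoc, neg_smul, sub_neg_eq_add, mul_comm (X (0, 1)) (X (1, 0))]

/-- **F1 at `(3,m)`, `m ≥ 4`, for the two-parameter quadratic class**: `ℓ^{m-2}·(α y₀₀y₁₁ + β y₀₁y₁₀)`
has the toric shape of `stub_formDebordering`'s conclusion, for all `α, β`. [folklore] -/
theorem formDebordering_padded_quadClass₃ (m : ℕ) [NeZero m] (hm : 4 ≤ m) (α β : ℂ) :
    let y : Fin 3 × Fin 3 → MvPolynomial (Fin m × Fin m) ℂ :=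
      fun ab => X (⟨m - 3 + ab.1, by omega⟩, ⟨m - 3 + ab.2, by omega⟩)
    ∃ (u g : Matrix.GeneralLinearGroup (Fin m × Fin m) ℂ) (w : Fin m × Fin m → ℕ) (e : ℕ) (a : ℂ),
      a ≠ 0 ∧
      (∀ d ∈ (linSubst (Fin m × Fin m) ℂ (g : Matrix (Fin m × Fin m) (Fin m × Fin m) ℂ)
          (detPoly (Fin m) ℂ)).support, Finsupp.weight w d ≤ e) ∧
      X ((0 : Fin m), (0 : Fin m)) ^ (m - 2) *
          aeval y (α • (X (0, 0) * X (1, 1)) + β • (X (0, 1) * X (1, 0)) :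
            MvPolynomial (Fin 3 × Fin 3) ℂ) =
        a • linSubst (Fin m × Fin m) ℂ (u : Matrix (Fin m × Fin m) (Fin m × Fin m) ℂ)
          (MvPolynomial.weightedHomogeneousComponent w e
            (linSubst (Fin m × Fin m) ℂ (g : Matrix (Fin m × Fin m) (Fin m × Fin m) ℂ)
              (detPoly (Fin m) ℂ))) := by
  have hq : (α • (X (0, 0) * X (1, 1)) + β • (X (0, 1) * X (1, 0)) :
      MvPolynomial (Fin 3 × Fin 3) ℂ).IsHomogeneous 2 := by
    rw [smul_eq_C_mul, smul_eq_C_mul]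
    exact (((isHomogeneous_X ℂ _).mul (isHomogeneous_X ℂ _)).C_mul α).add
      (((isHomogeneous_X ℂ _).mul (isHomogeneous_X ℂ _)).C_mul β)
  exact paddedBlock3_formDebordering_of_dc_le m hm (by omega) _ hq
    ((determinantalComplexity_le_of_hasDetRepr (hasDetRepr_quadClass₃ α β)).trans (by omega))

end Summit.ValiantsHypothesis.Cruxes.ToricFixedPoints.Negative
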